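import Literature.IUT.LogVolume.GenuineSupportPrimesBound
import Literature.IUT.LogVolume.GenuineLogThetaPointSchemaNegative
import HarnessLib

/-!
# [IUTchIV] Cor. 2.2 (ii) proof (P5)/(P7): what a genuine Θ-volume datum at `(P, l)` FORCES on the point —
# the necessity half of the binder list of the registered stub `stub_thetaData`, and the schema in `P`

Mochizuki, *Inter-universal Teichmüller theory IV*, RIMS manuscript (Apr. 2020; = PRIMS **57** (2021)), proof of
Cor. 2.2 (ii), p. 46: "(P5) `𝕍^bad_mod :=` the nonarchimedean valuations of `F_mod` that do not divide `2l` and at which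
`E_F` has bad multiplicative reduction; then `𝕍^bad_mod ≠ ∅`", "(P7) … there exist data `C̲_K`, `𝕍̲`, `ε̲` such that
all of the conditions of [IUTchI], Definition 3.1, (a)–(f), are satisfied"; [IUTchI] Def. 3.1 (b) "`V^bad_mod` is a
nonempty set of nonarchimedean valuations of `F_mod` of odd residue characteristic … bad [multiplicative] reduction",
(c) "`l` is prime to the elements of `V^bad_mod` as well as to the orders of the `q`-parameters".

Proof-only companion (cell `abc-iut`, seat abc-iut-f-198; FACT-LIST row F-2786 `Cor22.ThetaDataExistsAt`) of
abc-iut-S2's `GenuineLogThetaPoint.lean`. The typed existence predicate `Cor22.ThetaDataExistsAt P l := Nonempty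
(Cor22.ThetaVolumeDatumAt P l)` is a SCHEMA: abc-iut-w5-d239's `GenuineLogThetaPointSchemaNegative.lean` proves the
`l`-side necessity (`l.Prime ∧ 5 ≤ l`), and the crux child (i) `ThetaPartII.stub_thetaData` proves SUFFICIENCY of
`P ∈ UP, l prime ≥ 5, AdmitsCore P, CondP2 P l, CondP5 P l, CondP6 P l`. THIS FILE proves the `P`-side NECESSITY of
that binder list — read off the datum's `InitialThetaData` (Def. 3.1 (b)(c)) and its (P5) choice (`ThetaData.IsP5Choice`):

* `ThetaVolumeDatumAt.exists_mem_badPlacesAvoid_not_dvd` — a genuine datum at `(P, l)` produces a bad place `w` of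
  `λ` over `F_tpd` NOT dividing `2l` with `l ∤ ord_w j(λ)` (a place of `F` of multiplicative reduction over a member of
  `𝕍^bad_mod`, `j(E_F) = j(λ)`, read below in `F_tpd`; Def. 3.1 (c) for the divisibility);
* hence `ThetaVolumeDatumAt.condP5 : CondP5 P l`, `.inU : P.InU`, `.not_isIntegral_jInv`, `.jInv_ne_intCast`
  (in particular `j(λ) ≠ 0, 1728`), `.logQAvoid_pair_pos : 0 < log(q^{∤{2,l}}(λ))`, together with the point-level
  characterisations `condP5_iff_badPlacesAvoid_nonempty` and `logQAvoid_pair_pos_iff_condP5` (the converse of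
  abc-iut's `logQAvoid_pair_eq_zero_of_not_condP5`);
* existence level: `thetaDataExistsAt_imp` (`l.Prime ∧ 5 ≤ l ∧ P.InU ∧ CondP5 P l`), the contrapositives, and the
  VACUITY records `cor312AtDatum_of_not_condP5`, `cor312AtDatum_of_isIntegral_jInv`, `hullVolumeAtDatum_of_not_condP5`
  (off the (P5) locus the per-point claims hold for want of data — the cell's vacuity discipline);
* **the schema in `P`**: `exists_point_forall_not_thetaDataExistsAt` (`λ = 0` over `ℚ`: no datum for ANY `l`) and
  `not_forall_thetaDataExistsAt_of_prime_five_le` (repairing the `l`-side alone does not make the closure true).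

Classical algebraic number theory over the tree's typed definitions; nothing here constructs a datum, asserts
[IUTchIII] Cor. 3.12, or takes a side. [cite: Mochizuki2012, IUTchIV Cor. 2.2 (ii) proof p. 46]
[cite: Mochizuki2012, IUTchI Def. 3.1 (b)(c) p. 61–62] [claim: Mochizuki2012, status: disputed] for every IUT quotation.
-/

noncomputable section

open scoped Classical

namespace Literature.IUT.LogVolume

namespace Cor22

open NumberField IsDedekindDomain Literature.IUT.HodgeTheaters
open Literature.NumberTheory.DiophantineGeometry.GenEll

/-! ## Point-level bookkeeping: `j(λ)` at the excluded points, (P5) as a nonempty set, `log(q) > 0` -/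

section Point

/-- `j(0) = 0` for the tree's Legendre `j`-function `j(λ) = 2⁸(λ²−λ+1)³/(λ²(λ−1)²)` (division by zero).
[cite: Mochizuki2012, IUTchIV Cor. 2.2 p. 42] -/
theorem jInv_zero {F : Type*} [Field F] : jInv (0 : F) = 0 := by
  simp [jInv]

/-- `j(1) = 0` for the tree's Legendre `j`-function (division by zero). [cite: Mochizuki2012, IUTchIV Cor. 2.2 p. 42] -/
theorem jInv_one {F : Type*} [Field F] : jInv (1 : F) = 0 := by
  simp [jInv]

/-- Off `U_X = ℙ¹ ∖ {0, 1, ∞}` the (junk) value of `j(λ)` is `0`. [cite: Mochizuki2012, IUTchIV Cor. 2.2 p. 42] -/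
theorem jInv_eq_zero_of_not_inU {P : NFPoint} (h : ¬ P.InU) : jInv P.x = 0 := by
  unfold NFPoint.InU at h
  rw [not_and_or, not_ne_iff, not_ne_iff] at h
  rcases h with h | h
  · rw [h, jInv_zero]
  · rw [h, jInv_one]

/-- Off `U_X` the value `j(λ)` is an algebraic integer (namely `0`). [cite: Mochizuki2012, IUTchIV Cor. 2.2 p. 42] -/
theorem isIntegral_jInv_of_not_inU {P : NFPoint} (h : ¬ P.InU) : IsIntegral ℤ (jInv P.x) := by
  rw [jInv_eq_zero_of_not_inU h]
  exact isIntegral_zero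

/-- If `j(λ)` is an algebraic integer there are no bad places away from any `S`.
[cite: Mochizuki2012, IUTchIV Cor. 2.2 (ii) proof (P5) p. 46] -/
theorem badPlacesAvoid_eq_empty_of_isIntegral {P : NFPoint} (h : IsIntegral ℤ (jInv P.x)) (S : Finset ℕ) :
    badPlacesAvoid P S = ∅ := by
  unfold badPlacesAvoid
  rw [badPlaces_eq_empty_of_isIntegral h, Finset.filter_empty]

/-- **(P5) as a set**: `CondP5 P l` ("there is a place of `F_tpd` not dividing `2l` with `ord(j(λ)) < 0`") says exactly
that `𝕍(F_tpd)^bad` away from `{2, l}` (`badPlacesAvoid P {2, l}`) is nonempty.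
[cite: Mochizuki2012, IUTchIV Cor. 2.2 (ii) proof (P5) p. 46] -/
theorem condP5_iff_badPlacesAvoid_nonempty (P : NFPoint) (l : ℕ) :
    CondP5 P l ↔ (badPlacesAvoid P {2, l}).Nonempty := by
  unfold CondP5 badPlacesAvoid
  constructor
  · rintro ⟨v, hv, h2, hl⟩
    refine ⟨v, Finset.mem_filter.mpr ⟨(mem_badPlaces_iff_ord_neg P v).mpr hv, fun p hp => ?_⟩⟩
    rcases Finset.mem_insert.mp hp with rfl | hp
    · exact h2
    · rw [Finset.mem_singleton] at hp
      rw [hp]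
      exact hl
  · rintro ⟨v, hv⟩
    rw [Finset.mem_filter] at hv
    exact ⟨v, (mem_badPlaces_iff_ord_neg P v).mp hv.1, hv.2 2 (by simp), hv.2 l (by simp)⟩

/-- The local height `h_v = max(0, −ord_v j(λ))` is POSITIVE at a bad place.
[cite: Mochizuki2012, IUTchIV Cor. 2.2 (i) p. 41] -/
theorem localHeight_pos_of_mem_badPlaces {P : NFPoint} {v : HeightOneSpectrum (𝓞 P.F)} (hv : v ∈ badPlaces P) :
    0 < localHeight P v := by
  rw [mem_badPlaces_iff_ord_neg] at hv
  unfold localHeight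
  have h : 0 < (-(ord P.F v (jInv P.x))).toNat := Int.lt_toNat.mpr (by simpa using hv)
  exact_mod_cast h

/-- **`log(q^{∤S}(λ)) > 0` as soon as some bad place avoids `S`**: the `q`-parameter divisor is effective with a
positive coefficient `h_w ≥ 1` there. [cite: Mochizuki2012, IUTchIV Cor. 2.2 (i) p. 41] -/
theorem logQAvoid_pos_of_badPlacesAvoid_nonempty {P : NFPoint} {S : Finset ℕ} (h : (badPlacesAvoid P S).Nonempty) :
    0 < logQAvoid P S := by
  obtain ⟨w, hw⟩ := h
  have hdeg : (0 : ℝ) < (P.degree : ℝ) := by exact_mod_cast P.degree_pos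
  have hsum : 0 < (P.degree : ℝ) * logQAvoid P S := by
    rw [degree_mul_logQAvoid]
    refine Finset.sum_pos' (fun v _ => mul_nonneg (localHeight_nonneg P v) (logNorm_pos P.F v).le) ⟨w, hw, ?_⟩
    have hwb : w ∈ badPlaces P := (Finset.mem_filter.mp hw).1
    exact mul_pos (localHeight_pos_of_mem_badPlaces hwb) (logNorm_pos P.F w)
  exact (mul_pos_iff_of_pos_left hdeg).mp hsum

/-- **`log(q) > 0 ⟺ (P5)`** for `log(q) = log(q^{∤{2,l}}(λ))` of the constructed initial Θ-data (the converse of the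
tree's `logQAvoid_pair_eq_zero_of_not_condP5`). [cite: Mochizuki2012, IUTchIV Cor. 2.2 (ii) proof (P5) p. 46] -/
theorem logQAvoid_pair_pos_iff_condP5 (P : NFPoint) (l : ℕ) : 0 < logQAvoid P {2, l} ↔ CondP5 P l := by
  constructor
  · intro h
    by_contra h5
    rw [logQAvoid_pair_eq_zero_of_not_condP5 h5] at h
    exact lt_irrefl _ h
  · intro h5
    exact logQAvoid_pos_of_badPlacesAvoid_nonempty ((condP5_iff_badPlacesAvoid_nonempty P l).mp h5)

end Point

/-! ## At a genuine Θ-volume datum -/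

namespace ThetaVolumeDatumAt

variable {P : NFPoint} {l : ℕ}

/-- **A genuine Θ-volume datum at `(P, l)` produces a bad place of `λ/F_tpd` away from `{2, l}` at which `l ∤ ord j(λ)`.**
Take `v ∈ 𝕍^bad_mod ≠ ∅` (Def. 3.1 (b)) and a place `x` of `F` over it: `E_F` is multiplicative at `x` (Def. 3.1 (b)), so
`ord_x j(E_F) = −ord_x(Δ_min) < 0`; by the (P5) choice `x ∤ 2l`; by Def. 3.1 (c) `l` is prime to `ord_x(q_x) = ord_x(Δ_min)`.
Reading `j(E_F) = j(λ)` (`T.j_eq`) at the place `w` of `F_tpd` under `x` (`ord_x = e(x|w)·ord_w`) gives the claim.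
[cite: Mochizuki2012, IUTchIV Cor. 2.2 (ii) proof (P5) p. 46] [cite: Mochizuki2012, IUTchI Def. 3.1 (b)(c) p. 61–62] -/
theorem exists_mem_badPlacesAvoid_not_dvd (T : ThetaVolumeDatumAt P l) :
    ∃ w ∈ badPlacesAvoid P {2, l}, ¬ ((l : ℤ) ∣ ord P.F w (jInv P.x)) := by
  letI := T.instFieldF; letI := T.instNumberFieldF; letI := T.instAlgebraF; letI := T.instFieldK
  letI := T.instNumberFieldK; letI := T.instAlgebraK; letI := T.instFieldFbar; letI := T.instAlgebraFbar
  letI := T.instAlgebraKFbar; letI := T.instIsElliptic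
  -- a bad prime `v` of `F_mod` and a place `x` of `F` over it
  obtain ⟨v, hv⟩ := ThetaData.badPrimesMod_nonempty T.D
  obtain ⟨x, hxv⟩ := PlaceSection.exists_under_eq (F₀ := fieldOfModuli T.E) (K := T.F) v
  have hmult : T.E.HasMultiplicativeReductionAt x := ThetaData.hasMultiplicativeReductionAt_of_under T.D hv hxv
  have hVF : FinitePlace.mk x ∈ T.D.VFbad := ThetaData.mk_mem_VFbad_of_under T.D hv hxv
  -- the (P5) choice: `x ∤ 2`, `x ∤ l`
  have hP5 := (T.isP5Choice (FinitePlace.mk x)).mp hVF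
  rw [FinitePlace.maximalIdeal_mk] at hP5
  -- `ord_x j(E_F) < 0`, read as `ord_x j(λ) < 0`
  have hordx : ord T.F x T.E.j < 0 := ThetaData.ord_j_neg_of_hasMultiplicativeReductionAt hmult
  -- Def. 3.1 (c): `l` coprime to `ord_x(q_x) := ord_x(Δ_min)`
  have hcop : l.Coprime (T.E.ordMinimalDiscriminant x) := by
    have h := T.D.l_coprime_qParamOrd (FinitePlace.mk x) hVF
    rwa [FinitePlace.maximalIdeal_mk] at h
  -- `ord_x j(E_F) = −ord_x(Δ_min)`
  have hordj : ord T.F x T.E.j = -(T.E.ordMinimalDiscriminant x : ℤ) := by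
    unfold ord
    rw [T.E.log_valuation_j_eq_ordMinimalDiscriminant_of_hasMultiplicativeReductionAt x hmult]
  set w := finBelow P.F T.F x with hw
  refine ⟨w, ?_, ?_⟩
  · unfold badPlacesAvoid
    rw [Finset.mem_filter, mem_badPlaces_iff_ord_neg]
    rw [T.j_eq] at hordx
    exact ⟨(ord_algebraMap_neg_iff x (jInv P.x)).mp hordx, fun p hp hmem =>
      hP5.1 p hp ((natCast_mem_asIdeal_finBelow_iff (F := P.F) x p).mp hmem)⟩
  · intro hdvd
    -- `l ∣ ord_w j(λ)` ⇒ `l ∣ e(x|w)·ord_w j(λ) = ord_x j(E_F) = −ord_x(Δ_min)` ⇒ `l ∣ ord_x(Δ_min)` ⇒ `l = 1`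
    have h1 : (l : ℤ) ∣ ord T.F x T.E.j := by
      rw [T.j_eq, ord_algebraMap_eq x (jInv P.x)]
      exact Dvd.dvd.mul_left hdvd _
    rw [hordj, dvd_neg, Int.natCast_dvd_natCast] at h1
    exact T.D.l_prime.one_lt.ne' (Nat.Coprime.eq_one_of_dvd hcop h1)

/-- **`𝕍(F_tpd)^bad` away from `{2, l}` is nonempty at a genuine datum.**
[cite: Mochizuki2012, IUTchIV Cor. 2.2 (ii) proof (P5) p. 46] -/
theorem badPlacesAvoid_nonempty (T : ThetaVolumeDatumAt P l) : (badPlacesAvoid P {2, l}).Nonempty := by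
  obtain ⟨w, hw, -⟩ := T.exists_mem_badPlacesAvoid_not_dvd
  exact ⟨w, hw⟩

/-- **(P5) is NECESSARY**: every genuine Θ-volume datum at `(P, l)` has `CondP5 P l` — the binder `CondP5 P l` of
`ThetaPartII.stub_thetaData` is forced by its conclusion. [cite: Mochizuki2012, IUTchIV Cor. 2.2 (ii) proof (P5) p. 46] -/
theorem condP5 (T : ThetaVolumeDatumAt P l) : CondP5 P l :=
  (condP5_iff_badPlacesAvoid_nonempty P l).mpr T.badPlacesAvoid_nonempty

/-- (P2) AT THE EXTRACTED PLACE: a genuine datum yields a bad place `w ∤ 2l` of `λ/F_tpd` with `ord_w j(λ) < 0` and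
`l ∤ ord_w j(λ)` (Def. 3.1 (c) "prime to the orders of the `q`-parameters", read below in `F_tpd`). The full (P2)
(`Cor22.CondP2`: at EVERY bad place) is not forced — Def. 3.1 constrains only the places over `𝕍^bad_mod`.
[cite: Mochizuki2012, IUTchIV Cor. 2.2 (ii) proof (P2) p. 45] [cite: Mochizuki2012, IUTchI Def. 3.1 (c) p. 62] -/
theorem exists_ord_jInv_neg_not_dvd (T : ThetaVolumeDatumAt P l) :
    ∃ w : HeightOneSpectrum (𝓞 P.F), ord P.F w (jInv P.x) < 0 ∧ ((2 : ℕ) : 𝓞 P.F) ∉ w.asIdeal ∧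
      ((l : ℕ) : 𝓞 P.F) ∉ w.asIdeal ∧ ¬ ((l : ℤ) ∣ ord P.F w (jInv P.x)) := by
  obtain ⟨w, hw, hdvd⟩ := T.exists_mem_badPlacesAvoid_not_dvd
  unfold badPlacesAvoid at hw
  rw [Finset.mem_filter, mem_badPlaces_iff_ord_neg] at hw
  exact ⟨w, hw.1, hw.2 2 (by simp), hw.2 l (by simp), hdvd⟩

/-- **`λ` has a bad place** (a pole of `j(λ)`) at a genuine datum. [cite: Mochizuki2012, IUTchIV Cor. 2.2 (ii) proof (P5) p. 46] -/
theorem badPlaces_nonempty (T : ThetaVolumeDatumAt P l) : (badPlaces P).Nonempty := by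
  obtain ⟨w, hw⟩ := T.badPlacesAvoid_nonempty
  exact ⟨w, (Finset.mem_filter.mp hw).1⟩

/-- **`j(λ)` is NOT an algebraic integer** at a genuine datum (potentially multiplicative reduction somewhere): the
integral-`j` locus of the `λ`-line — in particular every CM point with `j ∈ {0, 1728}` — carries NO genuine Θ-volume datum
for any `l`. [cite: Mochizuki2012, IUTchIV Cor. 2.2 (ii) proof (P5) p. 46] -/
theorem not_isIntegral_jInv (T : ThetaVolumeDatumAt P l) : ¬ IsIntegral ℤ (jInv P.x) := by
  intro h
  have hne := T.badPlaces_nonempty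
  rw [badPlaces_eq_empty_of_isIntegral h] at hne
  exact Finset.not_nonempty_empty hne

/-- **`j(λ)` is not a rational integer** at a genuine datum; with `n = 0, 1728` this is two of the four values excluded by
"admits an `F`-core" (`Cor22.AdmitsCore`, p. 43) — the other two, `2¹⁴·31³/5³` and `2²·73³/3⁴`, are NOT excluded by
[IUTchI] Def. 3.1 as typed (the `K`-coricity of `C_K` is not a field of `InitialThetaData`).
[cite: Mochizuki2012, IUTchIV Cor. 2.2 (ii) proof p. 43] -/
theorem jInv_ne_intCast (T : ThetaVolumeDatumAt P l) (n : ℤ) : jInv P.x ≠ (n : P.F) := by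
  intro h
  apply T.not_isIntegral_jInv
  rw [h]
  exact isIntegral_algebraMap

/-- `j(λ) ≠ 0` at a genuine datum. [cite: Mochizuki2012, IUTchIV Cor. 2.2 (ii) proof p. 42–43] -/
theorem jInv_ne_zero (T : ThetaVolumeDatumAt P l) : jInv P.x ≠ 0 := by
  have h := T.jInv_ne_intCast 0
  rwa [Int.cast_zero] at h

/-- `j(λ) ≠ 1728` at a genuine datum. [cite: Mochizuki2012, IUTchIV Cor. 2.2 (ii) proof p. 42–43] -/
theorem jInv_ne_1728 (T : ThetaVolumeDatumAt P l) : jInv P.x ≠ 1728 := by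
  have h := T.jInv_ne_intCast 1728
  norm_cast at h

/-- **`λ ∈ U_X` is NECESSARY**: a genuine Θ-volume datum lives over a point of `U_X = ℙ¹ ∖ {0, 1, ∞}` (off `U_X` the
typed `j(λ)` is the integer `0`) — the hypothesis `hU : P.InU` of the summit-side dictionary (`LDHGenuinePoint`) is a
consequence of the datum. [cite: Mochizuki2012, IUTchIV Cor. 2.2 (ii) proof p. 42] -/
theorem inU (T : ThetaVolumeDatumAt P l) : P.InU := by
  by_contra h
  exact T.not_isIntegral_jInv (isIntegral_jInv_of_not_inU h)

/-- **`log(q) = log(q^{∤{2,l}}(λ)) > 0` at a genuine datum** — so the datum's `−|log(q)| = −(1/2l)·log(q)` (summit-side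
`PointDict.negAbsLogQ_eq`) is NEGATIVE, never the degenerate `0`. [cite: Mochizuki2012, IUTchIV Thm. 1.10 p. 23] -/
theorem logQAvoid_pair_pos (T : ThetaVolumeDatumAt P l) : 0 < logQAvoid P {2, l} :=
  logQAvoid_pos_of_badPlacesAvoid_nonempty T.badPlacesAvoid_nonempty

/-- `log(q^∀(λ)) > 0` at a genuine datum. [cite: Mochizuki2012, IUTchIV Cor. 2.2 (i) p. 41] -/
theorem logQForall_pos (T : ThetaVolumeDatumAt P l) : 0 < logQForall P := by
  obtain ⟨w, hw⟩ := T.badPlaces_nonempty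
  refine logQAvoid_pos_of_badPlacesAvoid_nonempty ⟨w, ?_⟩
  unfold badPlacesAvoid
  rw [Finset.mem_filter]
  exact ⟨hw, fun p hp => absurd hp (Finset.notMem_empty p)⟩

end ThetaVolumeDatumAt

/-! ## At the existence predicate `ThetaDataExistsAt P l` (FACT-LIST F-2786) -/

section Exists

variable {P : NFPoint} {l : ℕ}

/-- **What `ThetaDataExistsAt P l` forces on `(P, l)`**: `l` prime `≥ 5` (abc-iut-w5-d239), `λ ∈ U_X`, and (P5).
Of the seven binders of `ThetaPartII.stub_thetaData` (`P ∈ UP`, `l.Prime`, `5 ≤ l`, `AdmitsCore P`, `CondP2 P l`,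
`CondP5 P l`, `CondP6 P l`) these four are NECESSARY; `IsMinimal` is a presentation choice, and `AdmitsCore`, the full
`CondP2`, `CondP6` are not consequences of [IUTchI] Def. 3.1 as typed. [cite: Mochizuki2012, IUTchIV Cor. 2.2 (ii) proof p. 46] -/
theorem thetaDataExistsAt_imp (h : ThetaDataExistsAt P l) : l.Prime ∧ 5 ≤ l ∧ P.InU ∧ CondP5 P l := by
  obtain ⟨T⟩ := h
  exact ⟨T.prime_and_five_le.1, T.prime_and_five_le.2, T.inU, T.condP5⟩

/-- (P5) is necessary for the existence of a genuine datum. [cite: Mochizuki2012, IUTchIV Cor. 2.2 (ii) proof (P5) p. 46] -/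
theorem condP5_of_thetaDataExistsAt (h : ThetaDataExistsAt P l) : CondP5 P l :=
  (thetaDataExistsAt_imp h).2.2.2

/-- `λ ∈ U_X` is necessary for the existence of a genuine datum. [cite: Mochizuki2012, IUTchIV Cor. 2.2 (ii) proof p. 42] -/
theorem inU_of_thetaDataExistsAt (h : ThetaDataExistsAt P l) : P.InU :=
  (thetaDataExistsAt_imp h).2.2.1

/-- `log(q^{∤{2,l}}(λ)) > 0` is necessary for the existence of a genuine datum. [cite: Mochizuki2012, IUTchIV Thm. 1.10 p. 23] -/
theorem logQAvoid_pair_pos_of_thetaDataExistsAt (h : ThetaDataExistsAt P l) : 0 < logQAvoid P {2, l} := by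
  obtain ⟨T⟩ := h
  exact T.logQAvoid_pair_pos

/-- **F-2786 is a schema in `P`**: off the (P5) locus there is NO genuine Θ-volume datum at `(P, l)`.
[cite: Mochizuki2012, IUTchIV Cor. 2.2 (ii) proof (P5) p. 46] -/
theorem not_thetaDataExistsAt_of_not_condP5 (h : ¬ CondP5 P l) : ¬ ThetaDataExistsAt P l :=
  fun hex => h (condP5_of_thetaDataExistsAt hex)

/-- **F-2786 is a schema in `P`**: at a point with integral `j(λ)` there is NO genuine Θ-volume datum, for ANY `l`.
[cite: Mochizuki2012, IUTchIV Cor. 2.2 (ii) proof (P5) p. 46] -/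
theorem not_thetaDataExistsAt_of_isIntegral_jInv (h : IsIntegral ℤ (jInv P.x)) : ¬ ThetaDataExistsAt P l := by
  rintro ⟨T⟩
  exact T.not_isIntegral_jInv h

/-- Off `U_X` there is NO genuine Θ-volume datum, for any `l`. [cite: Mochizuki2012, IUTchIV Cor. 2.2 (ii) proof p. 42] -/
theorem not_thetaDataExistsAt_of_not_inU (h : ¬ P.InU) : ¬ ThetaDataExistsAt P l :=
  fun hex => h (inU_of_thetaDataExistsAt hex)

/-- VACUITY RECORD: off the (P5) locus `Cor312AtDatum P l` holds for want of data (to be read together with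
`ThetaDataExistsAt`, never as content). [cite: Mochizuki2012, IUTchIV Cor. 2.2 (ii) proof p. 46] -/
theorem cor312AtDatum_of_not_condP5 (h : ¬ CondP5 P l) : Cor312AtDatum P l :=
  cor312AtDatum_of_not_exists (not_thetaDataExistsAt_of_not_condP5 h)

/-- VACUITY RECORD: at integral `j(λ)` (e.g. the CM points `j = 0, 1728`) `Cor312AtDatum P l` holds for want of data.
[cite: Mochizuki2012, IUTchIV Cor. 2.2 (ii) proof p. 46] -/
theorem cor312AtDatum_of_isIntegral_jInv (h : IsIntegral ℤ (jInv P.x)) : Cor312AtDatum P l :=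
  cor312AtDatum_of_not_exists (not_thetaDataExistsAt_of_isIntegral_jInv h)

/-- VACUITY RECORD: off `U_X` `Cor312AtDatum P l` holds for want of data. [cite: Mochizuki2012, IUTchIV Cor. 2.2 (ii) proof p. 46] -/
theorem cor312AtDatum_of_not_inU (h : ¬ P.InU) : Cor312AtDatum P l :=
  cor312AtDatum_of_not_exists (not_thetaDataExistsAt_of_not_inU h)

/-- VACUITY RECORD for the computable half: off the (P5) locus `HullVolumeAtDatum P l δ` holds for every `δ`, for
want of data. [cite: Mochizuki2012, IUTchIV Thm. 1.10 Steps (v)–(viii) p. 27–31] -/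
theorem hullVolumeAtDatum_of_not_condP5 (h : ¬ CondP5 P l) (δ : ℝ) : HullVolumeAtDatum P l δ :=
  fun T => absurd T.condP5 h

end Exists

/-! ## The schema in `P`: explicit points with no datum for any `l` -/

/-- At the cusp `λ = 0` (presented over `ℚ`) there is NO genuine Θ-volume datum, whatever `l`.
[cite: Mochizuki2012, IUTchIV Cor. 2.2 (ii) proof p. 42] -/
theorem not_thetaDataExistsAt_rat_zero (l : ℕ) : ¬ ThetaDataExistsAt { F := ℚ, x := 0 } l :=
  not_thetaDataExistsAt_of_not_inU (fun h => h.1 rfl)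

/-- **F-2786 is a schema in `P`** (complement of abc-iut-w5-d239's `exists_not_thetaDataExistsAt`, the schema in `l`):
some point of the `λ`-line carries no genuine Θ-volume datum for ANY `l`. [cite: Mochizuki2012, IUTchIV Cor. 2.2 (ii) proof p. 46] -/
theorem exists_point_forall_not_thetaDataExistsAt : ∃ P : NFPoint, ∀ l : ℕ, ¬ ThetaDataExistsAt P l :=
  ⟨{ F := ℚ, x := 0 }, not_thetaDataExistsAt_rat_zero⟩

/-- **The `l`-repaired universal closure of F-2786 is still false**: even restricted to primes `l ≥ 5` ([IUTchI] Def. 3.1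
(c)), "a genuine Θ-volume datum exists at `(P, l)`" fails at some point (witness `λ = 0` over `ℚ`, `l = 5`) — the row is a
schema in BOTH arguments; its printed instance is the (P1)–(P7) configuration of the proof of Cor. 2.2 (ii), landed as
`ThetaPartII.stub_thetaData`. [cite: Mochizuki2012, IUTchIV Cor. 2.2 (ii) proof p. 46] -/
theorem not_forall_thetaDataExistsAt_of_prime_five_le :
    ¬ ∀ (P : NFPoint) (l : ℕ), l.Prime → 5 ≤ l → ThetaDataExistsAt P l :=
  fun h => not_thetaDataExistsAt_rat_zero 5 (h _ 5 (by norm_num) le_rfl)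

end Cor22

end Literature.IUT.LogVolume

end
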